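import Mathlib
import HarnessLib

/-!
# Item `LrcModEntire` (stmt-NavierStokesRegularity-20428), registry twist_split v7 — THE VERTICAL LINE LEMMA (memo `Cruxes/LrcModEntire/T2B-g14.md` §14d):
# class-free core of the «hyperbolic layer» dichotomy for the slope function of a (TH) thread plane

LEAD of item 20428 ns-poloidal-K2-p3 g14 (`--supports stmt-NavierStokesRegularity-20428 --as helper`).  Along the vertical line through a non-degenerate hot point `y` of the
(TH) column one has, with `a(z) = θ(y + z e₂)`, `b(z) = Δₕθ(y + z e₂)` and the slope function `μ(z) = μ(−1, z)`: the plane-wave identity `a″ = −μ·b` on an interval round `0`,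
`a ≤ a(0) = N` (hot-spot normalisation), `a′(0) = 0` (criticality), `b(0) = Δₕθ(y) < 0` (non-degeneracy) and `μ` ANALYTIC at `0` (ratio of analytic entries).  This file proves
the purely one-dimensional consequence:

* `slope_dichotomy_of_verticalLine` — under exactly these hypotheses **either `μ = 0` near `0`, or `μ < 0` on a punctured neighbourhood of `0`** (so `μ(z) = zⁿg(z)` with `n`
  even and `g(0) < 0`): the thread plane never borders an elliptic layer.  Proof: isolated zeros of analytic functions (`μ = zⁿ g`, `g(0) ≠ 0`) and two monotonicity arguments
  (`a″ > 0` on a one-sided interval next to `0` together with `a′(0) = 0` would push `a` above `a(0)`).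
* helpers `exists_gt_of_deriv2_pos_right` / `exists_gt_of_deriv2_pos_left` — the one-sided second-derivative tests used.

WHAT THIS IS NOT: not a claim about Navier–Stokes regularity — a calculus lemma serving the sub-cell «μ₀ = 0» of `stub_T2b` (bears_on LADDER-NS N0, item 20428 / crux 19708; both
OPEN, ⟨27893⟩ OPEN).
-/

set_option linter.style.longLine false
set_option linter.dupNamespace false

namespace Summit.NavierStokesRegularity.NavierStokesRegularity.Theorems.PoloidalWindowDoorLrcModEntireTwistingTHVerticalLine

open Set Function Filter Topology Metric

/-- One-sided second-derivative test (right): if `a′` has a positive derivative on `(0, δ)`, `a′` is continuous on `[0, δ)`-ish (we ask `HasDerivAt` on `(−δ, δ)`) and `a′(0) = 0`,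
then `a(z) > a(0)` for some `z ∈ (0, δ)`. -/
theorem exists_gt_of_deriv2_pos_right {a a' a'' : ℝ → ℝ} {δ : ℝ} (hδ : 0 < δ)
    (ha : ∀ z ∈ Ioo (-δ) δ, HasDerivAt a (a' z) z) (ha' : ∀ z ∈ Ioo (-δ) δ, HasDerivAt a' (a'' z) z)
    (ha'0 : a' 0 = 0) (hpos : ∀ z ∈ Ioo 0 δ, 0 < a'' z) : ∃ z ∈ Ioo 0 δ, a 0 < a z := by
  have hsub : Icc 0 (δ / 2) ⊆ Ioo (-δ) δ := fun z hz => ⟨by linarith [hz.1], by linarith [hz.2]⟩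
  -- `a'` is strictly increasing on `[0, δ/2]`
  have hmono' : StrictMonoOn a' (Icc 0 (δ / 2)) := by
    refine strictMonoOn_of_deriv_pos (convex_Icc _ _) ?_ ?_
    · exact fun z hz => (ha' z (hsub hz)).continuousAt.continuousWithinAt
    · intro z hz
      rw [interior_Icc] at hz
      rw [(ha' z (hsub (Ioo_subset_Icc_self hz))).deriv]
      exact hpos z ⟨hz.1, by linarith [hz.2]⟩
  have hpos' : ∀ z ∈ Ioo 0 (δ / 2), 0 < a' z := by
    intro z hz
    have h := hmono' (left_mem_Icc.2 (by linarith)) ⟨hz.1.le, hz.2.le⟩ hz.1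
    rwa [ha'0] at h
  -- hence `a` is strictly increasing on `[0, δ/2]`
  have hmono : StrictMonoOn a (Icc 0 (δ / 2)) := by
    refine strictMonoOn_of_deriv_pos (convex_Icc _ _) ?_ ?_
    · exact fun z hz => (ha z (hsub hz)).continuousAt.continuousWithinAt
    · intro z hz
      rw [interior_Icc] at hz
      rw [(ha z (hsub (Ioo_subset_Icc_self hz))).deriv]
      exact hpos' z hz
  refine ⟨δ / 4, ⟨by linarith, by linarith⟩, ?_⟩
  exact hmono (left_mem_Icc.2 (by linarith)) ⟨by linarith, by linarith⟩ (by linarith)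

/-- One-sided second-derivative test (left): if `a″ > 0` on `(−δ, 0)` and `a′(0) = 0`, then `a(z) > a(0)` for some `z ∈ (−δ, 0)`. -/
theorem exists_gt_of_deriv2_pos_left {a a' a'' : ℝ → ℝ} {δ : ℝ} (hδ : 0 < δ)
    (ha : ∀ z ∈ Ioo (-δ) δ, HasDerivAt a (a' z) z) (ha' : ∀ z ∈ Ioo (-δ) δ, HasDerivAt a' (a'' z) z)
    (ha'0 : a' 0 = 0) (hpos : ∀ z ∈ Ioo (-δ) 0, 0 < a'' z) : ∃ z ∈ Ioo (-δ) 0, a 0 < a z := by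
  -- reflect: `ã(z) = a(−z)`
  have hra : ∀ z ∈ Ioo (-δ) δ, HasDerivAt (fun z => a (-z)) (-(a' (-z))) z := by
    intro z hz
    have h : HasDerivAt (fun z => a (-z)) (a' (-z) * -1) z :=
      (ha (-z) ⟨by linarith [hz.2], by linarith [hz.1]⟩).comp z (hasDerivAt_neg z)
    simpa only [mul_neg, mul_one] using h
  have hra' : ∀ z ∈ Ioo (-δ) δ, HasDerivAt (fun z => -(a' (-z))) (a'' (-z)) z := by
    intro z hz
    have h : HasDerivAt (fun z => a' (-z)) (a'' (-z) * -1) z :=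
      (ha' (-z) ⟨by linarith [hz.2], by linarith [hz.1]⟩).comp z (hasDerivAt_neg z)
    have h2 := h.neg
    simp only [mul_neg, mul_one, neg_neg] at h2
    exact h2
  obtain ⟨z, hz, hlt⟩ := exists_gt_of_deriv2_pos_right (a := fun z => a (-z)) (a' := fun z => -(a' (-z))) (a'' := fun z => a'' (-z))
    hδ hra hra' (by simp [ha'0]) (fun z hz => hpos (-z) ⟨by linarith [hz.2], by linarith [hz.1]⟩)
  exact ⟨-z, ⟨by linarith [hz.2], by linarith [hz.1]⟩, by simpa using hlt⟩

/-- **THE VERTICAL LINE LEMMA.**  `a″ = −μ·b` on `(−δ, δ)`, `a ≤ a(0)` there, `a′(0) = 0`, `b` continuous at `0` with `b(0) < 0`, `μ` analytic at `0` ⇒ either `μ = 0` near `0` or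
`μ < 0` on a punctured neighbourhood of `0`. -/
theorem slope_dichotomy_of_verticalLine {a a' b μ : ℝ → ℝ} {δ : ℝ} (hδ : 0 < δ)
    (ha : ∀ z ∈ Ioo (-δ) δ, HasDerivAt a (a' z) z) (ha' : ∀ z ∈ Ioo (-δ) δ, HasDerivAt a' (-(μ z * b z)) z)
    (hmax : ∀ z ∈ Ioo (-δ) δ, a z ≤ a 0) (ha'0 : a' 0 = 0)
    (hb : ContinuousAt b 0) (hb0 : b 0 < 0) (hμ : AnalyticAt ℝ μ 0) :
    (∀ᶠ z in 𝓝 0, μ z = 0) ∨ (∀ᶠ z in 𝓝[≠] 0, μ z < 0) := by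
  by_cases hzero : ∀ᶠ z in 𝓝 0, μ z = 0
  · exact Or.inl hzero
  right
  obtain ⟨n, g, hg, hg0, hμg⟩ := hμ.exists_eventuallyEq_pow_smul_nonzero_iff.2 hzero
  simp only [sub_zero, smul_eq_mul] at hμg
  -- the continuous factor `c = g·b` keeps the sign of `c(0) ≠ 0` near `0`
  have hc : ContinuousAt (fun z => g z * b z) 0 := hg.continuousAt.mul hb
  have hc0 : g 0 * b 0 ≠ 0 := mul_ne_zero hg0 hb0.ne
  have hsign : ∀ᶠ z in 𝓝 0, (0 < g 0 * b 0 → 0 < g z * b z) ∧ (g 0 * b 0 < 0 → g z * b z < 0) := by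
    rcases lt_or_gt_of_ne hc0 with hneg | hpos
    · filter_upwards [hc.eventually (gt_mem_nhds hneg)] with z hz
      exact ⟨fun h => absurd h (not_lt.2 hneg.le), fun _ => hz⟩
    · filter_upwards [hc.eventually (lt_mem_nhds hpos)] with z hz
      exact ⟨fun _ => hz, fun h => absurd h (not_lt.2 hpos.le)⟩
  have hgsign : ∀ᶠ z in 𝓝 0, (g 0 < 0 → g z < 0) := by
    by_cases hg0' : g 0 < 0
    · filter_upwards [hg.continuousAt.eventually (gt_mem_nhds hg0')] with z hz
      exact fun _ => hz
    · exact Eventually.of_forall fun z h => absurd h hg0'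
  have hball : ∀ᶠ z in 𝓝 (0 : ℝ), z ∈ Ioo (-δ) δ := Ioo_mem_nhds (by linarith) hδ
  obtain ⟨δ₁, hδ₁, hB⟩ := Metric.eventually_nhds_iff.1 ((hμg.and hsign).and (hgsign.and hball))
  have hB' : ∀ z : ℝ, |z| < δ₁ → (μ z = z ^ n * g z ∧ ((0 < g 0 * b 0 → 0 < g z * b z) ∧ (g 0 * b 0 < 0 → g z * b z < 0))) ∧
      ((g 0 < 0 → g z < 0) ∧ z ∈ Ioo (-δ) δ) := fun z hz => hB (by rwa [dist_zero_right, Real.norm_eq_abs])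
  set δ₂ : ℝ := min δ₁ δ with hδ₂
  have hδ₂0 : 0 < δ₂ := lt_min hδ₁ hδ
  have hδ₂1 : δ₂ ≤ δ₁ := min_le_left _ _
  have hδ₂δ : δ₂ ≤ δ := min_le_right _ _
  -- derivatives on the smaller interval
  have ha2 : ∀ z ∈ Ioo (-δ₂) δ₂, HasDerivAt a (a' z) z := fun z hz => ha z ⟨by linarith [hz.1], by linarith [hz.2]⟩
  have ha'2 : ∀ z ∈ Ioo (-δ₂) δ₂, HasDerivAt a' ((fun z => -(μ z * b z)) z) z := fun z hz => ha' z ⟨by linarith [hz.1], by linarith [hz.2]⟩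
  -- case 1: `c(0) < 0` ⇒ `a″ > 0` on `(0, δ₂)` ⇒ contradiction
  rcases lt_or_gt_of_ne hc0 with hneg | hpos
  · exfalso
    have hpos'' : ∀ z ∈ Ioo 0 δ₂, 0 < (fun z => -(μ z * b z)) z := by
      intro z hz
      obtain ⟨⟨hμz, hs⟩, -⟩ := hB' z (by rw [abs_of_pos hz.1]; linarith [hz.2])
      have hcz : g z * b z < 0 := hs.2 hneg
      have hzn : 0 < z ^ n := pow_pos hz.1 n
      show 0 < -(μ z * b z)
      rw [hμz]; nlinarith
    obtain ⟨z, hz, hlt⟩ := exists_gt_of_deriv2_pos_right hδ₂0 ha2 ha'2 ha'0 hpos''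
    exact absurd (hmax z ⟨by linarith [hz.1], by linarith [hz.2]⟩) (not_le.2 hlt)
  · -- case 2: `c(0) > 0`; then `n` is even (else `a″ > 0` on `(−δ₂, 0)`), and `g(0) < 0`
    have hg0neg : g 0 < 0 := by
      by_contra h
      have hg0pos : 0 < g 0 := lt_of_le_of_ne (not_lt.1 h) (Ne.symm hg0)
      nlinarith
    rcases Nat.even_or_odd n with heven | hodd
    · -- conclusion
      rw [eventually_nhdsWithin_iff]
      filter_upwards [Metric.ball_mem_nhds (0 : ℝ) hδ₁] with z hz hz0
      have hz' : |z| < δ₁ := by rwa [Metric.mem_ball, dist_zero_right, Real.norm_eq_abs] at hz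
      obtain ⟨⟨hμz, -⟩, hgs, -⟩ := hB' z hz'
      have hzn : 0 < z ^ n := heven.pow_pos hz0
      rw [hμz]
      exact mul_neg_of_pos_of_neg hzn (hgs hg0neg)
    · exfalso
      have hpos'' : ∀ z ∈ Ioo (-δ₂) 0, 0 < (fun z => -(μ z * b z)) z := by
        intro z hz
        obtain ⟨⟨hμz, hs⟩, -⟩ := hB' z (by rw [abs_of_neg hz.2]; linarith [hz.1])
        have hcz : 0 < g z * b z := hs.1 hpos
        have hzn : z ^ n < 0 := hodd.pow_neg hz.2
        show 0 < -(μ z * b z)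
        rw [hμz]; nlinarith
      obtain ⟨z, hz, hlt⟩ := exists_gt_of_deriv2_pos_left hδ₂0 ha2 ha'2 ha'0 hpos''
      exact absurd (hmax z ⟨by linarith [hz.1], by linarith [hz.2]⟩) (not_le.2 hlt)

end Summit.NavierStokesRegularity.NavierStokesRegularity.Theorems.PoloidalWindowDoorLrcModEntireTwistingTHVerticalLine
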